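import Literature.Probability.LatticeModels.RightmostInterfaceTightness
import Literature.Probability.RandomPlanarGeometry.SLEUniquenessInLaw
import HarnessLib

/-!
# Critical Ising interfaces and SLE₃: the rightmost interface, convergence modulo identification

Topic `Literature/Probability/LatticeModels` (family `crit-ising`). Mirror of
`InterfaceSLELeftmost.lean` for the **rightmost** interface of Chelkak–Duminil-Copin–Hongler–
Kemppainen–Smirnov (C. R. Math. Acad. Sci. Paris 352 (2014), Theorem 1, §1: "We assume `γ^δ` to
be the rightmost (or the leftmost) interface"), `RightmostInterface.rightmostInterface`. It joins

* the **tightness of the laws of the rightmost interface** near `δ = 0`, PROVED modulo the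
  FK-Ising RSW fact `fkIsing_rsw`
  (`RightmostInterfaceTightness.exists_isTightMeasureSet_spinInterfaceLaw_rightmost`: the leftmost
  bound transported by the spin-flip / arc-exchange symmetry; CDHKS §2, Thm. 3), and
* the assembly **tightness ∧ identification ∧ uniqueness ⟹ convergence**
  (`convergesInLawToSLE_rightmostInterface_of_tight_of_ident`, Prokhorov and the subsequence
  principle, verbatim as `InterfaceSLEProofs.convergesInLawToSLE_leftmostInterface_of_tight_of_ident`;
  CDHKS §3, last sentence), with uniqueness in law of chordal SLE a theorem
  (`IsSLECurve.map_eq_holds`).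

Results (all PROVED):

* `exists_isInterfaceSelection_eq_rightmostInterface`, `isSLELaw_three_of_subseqLimit_rightmostInterface`
  — the identification fact F2 `isSLELaw_three_of_subseqLimit_spinInterface` (all selection
  rules) specialised to the rightmost interface;
* `convergesInLawToSLE_rightmostInterface_of_fkIsing_rsw_of_ident` — `fkIsing_rsw` and the
  identification of the weak subsequential limits of the rightmost interface laws as the SLE₃ law
  (hypothesis; CDHKS §3) give the convergence of the rightmost interfaces to SLE₃;
* `convergesInLawToSLE_rightmostInterface_of_fkIsing_rsw` — the same with the identification
  supplied by F2.

The named-fact frontier below CDHKS Theorem 1 for the rightmost interface along this line is thus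
the same as for the leftmost one: `fkIsing_rsw` (`FKIsingRSW.lean`) and F2.

## References

* D. Chelkak, H. Duminil-Copin, C. Hongler, A. Kemppainen, S. Smirnov, C. R. Math. Acad. Sci.
  Paris 352 (2014) 157–161 (arXiv:1312.0533): §1, Thm. 1, §2 (Thm. 3, Rem. 4), §3.
  [CDHKSCRAS2014]
* A. Kemppainen, S. Smirnov, Ann. Probab. 45 (2017) 698–779, Thm. 1.5, Rem. 2.10.
  [KemppainenSmirnov2017]
-/

noncomputable section

open MeasureTheory Filter Topology Set
open scoped NNReal ENNReal BoundedContinuousFunction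

namespace Literature.Probability.LatticeModels

/-- **A genuine selection rule agreeing with the rightmost interface at admissible meshes**: at
every mesh an interface-selection rule (`IsInterfaceSelection`), equal to `rightmostInterface (E δ)`
whenever `E δ` is admissible (elsewhere: some Dobrushin interface if one exists). This reduces
statements about the rightmost interface (CDHKS 2014, §1) to statements quantified over selection
rules. [cite: CDHKSCRAS2014, §1] -/
theorem exists_isInterfaceSelection_eq_rightmostInterface (E : ℝ → DiscreteDobrushin) :
    ∃ sel : ℝ → SpinConfig (Site 2) → List (Sym2 (Site 2)),
      (∀ δ, IsInterfaceSelection (E δ) (sel δ)) ∧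
      ∀ δ, (E δ).IsZdAdmissible → sel δ = rightmostInterface (E δ) := by
  classical
  have key : ∀ δ, ∃ s : SpinConfig (Site 2) → List (Sym2 (Site 2)),
      IsInterfaceSelection (E δ) s ∧ ((E δ).IsZdAdmissible → s = rightmostInterface (E δ)) := by
    intro δ
    by_cases h : (E δ).IsZdAdmissible
    · exact ⟨_, isInterfaceSelection_rightmostInterface h, fun _ ↦ rfl⟩
    · refine ⟨fun σ ↦ if hσ : ∃ γ, IsDobrushinInterface (E δ) σ γ then hσ.choose else [],
        fun σ hσ ↦ ?_, fun h' ↦ absurd h' h⟩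
      simp only [dif_pos hσ]
      exact hσ.choose_spec
  choose sel hsel hright using key
  exact ⟨sel, hsel, hright⟩

/-- **F2 for the rightmost interface.** Under the identification fact
`isSLELaw_three_of_subseqLimit_spinInterface` (CDHKS §3, all selection rules), every weak
subsequential limit of the laws of the rightmost interface along meshes `u n → 0⁺` is the chordal
SLE₃ law: along the tail where `E (u n)` is admissible these laws are the laws of a genuine
selection rule (`exists_isInterfaceSelection_eq_rightmostInterface`), to which F2 applies.
[cite: CDHKSCRAS2014, §3 (proof of Thm. 1)] -/
theorem isSLELaw_three_of_subseqLimit_rightmostInterface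
    (h₂ : isSLELaw_three_of_subseqLimit_spinInterface)
    {D : RandomPlanarGeometry.DobrushinDomain} {E : ℝ → DiscreteDobrushin} (hE : IsDiscretisation D E)
    {u : ℕ → ℝ} (hu : Tendsto u atTop (𝓝[>] 0))
    (ν : Measure (RandomPlanarGeometry.CurveClass ℂ)) [IsProbabilityMeasure ν]
    (hlim : ∀ f : RandomPlanarGeometry.CurveClass ℂ →ᵇ ℝ,
      Tendsto (fun n ↦ ∫ c, f c ∂spinInterfaceLaw D E (fun δ ↦ rightmostInterface (E δ)) (u n))
        atTop (𝓝 (∫ c, f c ∂ν))) :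
    RandomPlanarGeometry.IsSLELaw 3 D ν := by
  obtain ⟨sel, hsel, hright⟩ := exists_isInterfaceSelection_eq_rightmostInterface E
  refine h₂ D E hE sel hsel u hu ν fun f ↦ (hlim f).congr' ?_
  filter_upwards [hu.eventually hE.eventually_isZdAdmissible] with n hn
  rw [spinInterfaceLaw_congr D E (sel := sel) (sel' := fun δ ↦ rightmostInterface (E δ)) (hright _ hn)]

/-- **Convergence of the rightmost interface to SLE₃ from the two halves of CDHKS's proof, as
hypotheses about the rightmost interface only** (CDHKS 2014, Thm. 1 for the interface of §1): if
the laws of the rightmost critical spin-Ising Dobrushin interfaces of discrete Dobrushin data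
`E δ` of `(D; a, b)` are tight for `δ ∈ (0, δ₀]` (CDHKS §2) and every weak subsequential limit of
them along meshes `u n → 0⁺` is the chordal SLE₃ law (CDHKS §3), then, SLE laws being unique
(`IsSLECurve.map_eq`), the rightmost interface converges in law to chordal SLE₃ in `D` from `a` to
`b` as `δ → 0⁺` (Prokhorov and the subsequence principle, `exists_tendstoLaw_of_isTightMeasureSet`).
PROVED (the proof of `convergesInLawToSLE_leftmostInterface_of_tight_of_ident`, verbatim).
[cite: CDHKSCRAS2014, Thm. 1 and §3] -/
theorem convergesInLawToSLE_rightmostInterface_of_tight_of_ident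
    {D : RandomPlanarGeometry.DobrushinDomain} {E : ℝ → DiscreteDobrushin}
    (htight : ∃ δ₀ > 0, IsTightMeasureSet
      (spinInterfaceLaw D E (fun δ ↦ rightmostInterface (E δ)) '' Set.Ioc 0 δ₀))
    (hident : ∀ (u : ℕ → ℝ), Tendsto u atTop (𝓝[>] 0) →
      ∀ (ν : Measure (RandomPlanarGeometry.CurveClass ℂ)) [IsProbabilityMeasure ν],
        (∀ f : RandomPlanarGeometry.CurveClass ℂ →ᵇ ℝ,
          Tendsto (fun n ↦ ∫ c, f c ∂spinInterfaceLaw D E (fun δ ↦ rightmostInterface (E δ)) (u n))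
            atTop (𝓝 (∫ c, f c ∂ν))) →
        RandomPlanarGeometry.IsSLELaw 3 D ν)
    (huniq : RandomPlanarGeometry.IsSLECurve.map_eq) :
    RandomPlanarGeometry.ConvergesInLawToSLE 3 D (Ωδ := fun _ ↦ SpinConfig (Site 2))
      (fun δ σ ↦ spinInterfaceCurve D δ (rightmostInterface (E δ) σ))
      (fun δ ↦ isingZdDobrushinMeasure (E δ) criticalBetaTwo) := by
  have hY : ∀ δ, AEMeasurable (fun σ ↦ spinInterfaceCurve D δ (rightmostInterface (E δ) σ))
      (isingZdDobrushinMeasure (E δ) criticalBetaTwo) :=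
    fun δ ↦ aemeasurable_isingZdDobrushinMeasure _ _ _
  obtain ⟨δ₀, hδ₀, htight⟩ := htight
  obtain ⟨ν, hν, hQ, hT⟩ := exists_tendstoLaw_of_isTightMeasureSet
    (Ωδ := fun _ ↦ SpinConfig (Site 2))
    (P := fun δ ↦ isingZdDobrushinMeasure (E δ) criticalBetaTwo)
    hY hδ₀ htight (fun ν ↦ RandomPlanarGeometry.IsSLELaw 3 D ν)
    (fun u ν hu hν hf ↦ by
      haveI := hν
      refine hident u hu ν fun f ↦ ?_
      simpa only [spinInterfaceLaw, integral_map (hY _) f.continuous.aestronglyMeasurable]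
        using hf f)
    (fun ν ν' _ _ h h' ↦ RandomPlanarGeometry.IsSLELaw.unique huniq h h')
  obtain ⟨Γ, hΓ, rfl⟩ := hQ
  exact ⟨Γ, hΓ, Eventually.of_forall hY, hT Γ Process.preWienerMeasure hΓ.aemeasurable rfl⟩

/-- **Convergence of the rightmost critical Ising interface to SLE₃, from `fkIsing_rsw` and the
identification of subsequential limits.** For a discretised Dobrushin domain `(D; a, b)`, `E`
(`IsDiscretisation D E`): if every weak subsequential limit, along meshes `u n → 0⁺`, of the laws
of the rightmost critical spin-Ising Dobrushin interfaces is the chordal SLE₃ law in `(D; a, b)`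
(CDHKS §3), then the rightmost interface converges in law to chordal SLE₃ as `δ → 0⁺` — the
tightness half being `exists_isTightMeasureSet_spinInterfaceLaw_rightmost` (CDHKS §2, from
`fkIsing_rsw`) and uniqueness of the SLE law `IsSLECurve.map_eq_holds`. PROVED.
[cite: CDHKSCRAS2014, Thm. 1, §2 Thm. 3 and §3] -/
theorem convergesInLawToSLE_rightmostInterface_of_fkIsing_rsw_of_ident (h₁ : fkIsing_rsw)
    {D : RandomPlanarGeometry.DobrushinDomain} {E : ℝ → DiscreteDobrushin} (hE : IsDiscretisation D E)
    (hident : ∀ (u : ℕ → ℝ), Tendsto u atTop (𝓝[>] 0) →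
      ∀ (ν : Measure (RandomPlanarGeometry.CurveClass ℂ)) [IsProbabilityMeasure ν],
        (∀ f : RandomPlanarGeometry.CurveClass ℂ →ᵇ ℝ,
          Tendsto (fun n ↦ ∫ c, f c ∂spinInterfaceLaw D E (fun δ ↦ rightmostInterface (E δ)) (u n))
            atTop (𝓝 (∫ c, f c ∂ν))) →
        RandomPlanarGeometry.IsSLELaw 3 D ν) :
    RandomPlanarGeometry.ConvergesInLawToSLE 3 D (Ωδ := fun _ ↦ SpinConfig (Site 2))
      (fun δ σ ↦ spinInterfaceCurve D δ (rightmostInterface (E δ) σ))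
      (fun δ ↦ isingZdDobrushinMeasure (E δ) criticalBetaTwo) :=
  convergesInLawToSLE_rightmostInterface_of_tight_of_ident
    (exists_isTightMeasureSet_spinInterfaceLaw_rightmost h₁ hE) hident
    RandomPlanarGeometry.IsSLECurve.map_eq_holds

/-- **Convergence of the rightmost critical Ising interface to SLE₃, from `fkIsing_rsw` and F2.**
The identification hypothesis supplied by the named fact
`isSLELaw_three_of_subseqLimit_spinInterface` (CDHKS §3, all selection rules; specialised by
`isSLELaw_three_of_subseqLimit_rightmostInterface`). PROVED; named-fact frontier `fkIsing_rsw`, F2.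
[cite: CDHKSCRAS2014, Thm. 1 and §§2–3] -/
theorem convergesInLawToSLE_rightmostInterface_of_fkIsing_rsw (h₁ : fkIsing_rsw)
    (h₂ : isSLELaw_three_of_subseqLimit_spinInterface)
    {D : RandomPlanarGeometry.DobrushinDomain} {E : ℝ → DiscreteDobrushin} (hE : IsDiscretisation D E) :
    RandomPlanarGeometry.ConvergesInLawToSLE 3 D (Ωδ := fun _ ↦ SpinConfig (Site 2))
      (fun δ σ ↦ spinInterfaceCurve D δ (rightmostInterface (E δ) σ))
      (fun δ ↦ isingZdDobrushinMeasure (E δ) criticalBetaTwo) :=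
  convergesInLawToSLE_rightmostInterface_of_fkIsing_rsw_of_ident h₁ hE
    fun _u hu ν _ hlim ↦ isSLELaw_three_of_subseqLimit_rightmostInterface h₂ hE hu ν hlim

end Literature.Probability.LatticeModels

end
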